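/-
Copyright (c) 2026. Released under Apache 2.0 license.
Literature formalization: Chen–Voutier, the homogenised Padé polynomials and their Casoratian.
-/
import Mathlib
import Literature.NumberTheory.DiophantineApproximation.BinomialPadeRecurrence
import Literature.NumberTheory.DiophantineApproximation.ApproximationSequenceMeasure

/-!
# Homogenised diagonal Padé polynomials and the non-vanishing of their Casoratian

[cite: ChenVoutier1997, Lemma 1 (ii) (`X*_{n,r}(z,u) = u^r X_{n,r}(z/u)`), recurrence (2.9),
Lemma 7 (arXiv:1401.5450, Lemmas 2.3 and 2.7)]

J. H. Chen and P. M. Voutier, *Complete solution of the Diophantine equation `X² + 1 = dY⁴` and a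
related family of quartic Thue equations*, J. Number Theory **62** (1997), 71–99.

For the diagonal Padé polynomials `p_r(x) = ∑_ν C(r-α,r-ν) C(r+α,ν) x^ν`,
`q_r(x) = ∑_ν C(r-α,ν) C(r+α,r-ν) x^ν` of Lemma 2 (`m = n = r`) and complex `z, u`, the homogenised
values `P_r = u^r p_r(z/u) = ∑_ν C(r-α,r-ν) C(r+α,ν) z^ν u^{r-ν}` and `Q_r = u^r q_r(z/u)` are the
quantities `C(r-α,r) X*_{n,r}(z,u)`, `C(r-α,r) X*_{n,r}(u,z)` of Lemma 1 (ii) (`α = 1/n`).  They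
satisfy the homogenised recurrence (2.9),
`r(r+1) P_{r+1} = r(2r+1)(z+u) P_r - (r²-α²)(z-u)² P_{r-1}` (`homogPadeP_rec`, `homogPadeQ_rec`),
whence, by Lemma 7 (`casoratian_ne_zero`), `P_{r+1} Q_r ≠ P_r Q_{r+1}` for all `r` as soon as
`0 < |α| < 1`, `u ≠ 0` and `z ≠ u` (`homogPade_casoratian_ne_zero`; the initial value is
`P_1 Q_0 - P_0 Q_1 = 2α(z-u)`, the analogue of `K_1 L_0 - K_0 L_1 = 4h(n+1)PU(ad-bc)/9` in the
proof of Lemma 7).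
-/

open Finset

namespace Literature.NumberTheory.DiophantineApproximation

/-- Homogenisation: `∑_ν c_ν z^ν u^{r-ν} = u^r ∑_ν c_ν (z/u)^ν` for `u ≠ 0`
[cite: ChenVoutier1997, Notation before Lemma 1, `X*_{n,r}(X,Y) = Y^r X_{n,r}(X/Y)`]. -/
theorem homog_eq_pow_mul_sum (c : ℕ → ℝ) (z u : ℂ) (hu : u ≠ 0) (r : ℕ) :
    ∑ ν ∈ range (r + 1), (c ν : ℂ) * z ^ ν * u ^ (r - ν) =
      u ^ r * ∑ ν ∈ range (r + 1), (c ν : ℂ) * (z / u) ^ ν := by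
  rw [mul_sum]
  refine sum_congr rfl fun ν hν => ?_
  have hνr : ν ≤ r := Nat.lt_succ_iff.mp (mem_range.mp hν)
  rw [div_pow, ← pow_sub_mul_pow u hνr]
  field_simp

/-- **Homogenised recurrence for `P_r = u^r p_r(z/u)`** [cite: ChenVoutier1997, (2.9) with
Lemma 1 (ii)]: for `r ≥ 1` and `u ≠ 0`,
`r(r+1) P_{r+1} = r(2r+1)(z+u) P_r - (r²-α²)(z-u)² P_{r-1}`. -/
theorem homogPadeP_rec (α : ℝ) {r : ℕ} (hr : 1 ≤ r) (z u : ℂ) (hu : u ≠ 0) :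
    (r : ℂ) * (r + 1) * ∑ ν ∈ range (r + 1 + 1),
        ((Ring.choose ((((r + 1 : ℕ)) : ℝ) - α) (r + 1 - ν) *
          Ring.choose ((((r + 1 : ℕ)) : ℝ) + α) ν : ℝ) : ℂ) * z ^ ν * u ^ (r + 1 - ν) =
      (r : ℂ) * (2 * r + 1) * (z + u) * ∑ ν ∈ range (r + 1),
        ((Ring.choose ((r : ℝ) - α) (r - ν) * Ring.choose ((r : ℝ) + α) ν : ℝ) : ℂ) *
          z ^ ν * u ^ (r - ν) -
      ((r : ℂ) ^ 2 - (α : ℂ) ^ 2) * (z - u) ^ 2 * ∑ ν ∈ range (r - 1 + 1),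
        ((Ring.choose ((((r - 1 : ℕ)) : ℝ) - α) (r - 1 - ν) *
          Ring.choose ((((r - 1 : ℕ)) : ℝ) + α) ν : ℝ) : ℂ) * z ^ ν * u ^ (r - 1 - ν) := by
  rw [homog_eq_pow_mul_sum _ z u hu, homog_eq_pow_mul_sum _ z u hu, homog_eq_pow_mul_sum _ z u hu,
    show z + u = (z / u + 1) * u by field_simp, show z - u = (z / u - 1) * u by field_simp]
  have h := binomialPadeP_rec' α hr (z / u)
  obtain ⟨k, rfl⟩ : ∃ k, r = k + 1 := ⟨r - 1, by omega⟩
  simp only [Nat.add_sub_cancel] at h ⊢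
  linear_combination u ^ (k + 1 + 1) * h

/-- **Homogenised recurrence for `Q_r = u^r q_r(z/u)`** [cite: ChenVoutier1997, (2.9) with
Lemma 1 (ii)]: for `r ≥ 1` and `u ≠ 0`,
`r(r+1) Q_{r+1} = r(2r+1)(z+u) Q_r - (r²-α²)(z-u)² Q_{r-1}`. -/
theorem homogPadeQ_rec (α : ℝ) {r : ℕ} (hr : 1 ≤ r) (z u : ℂ) (hu : u ≠ 0) :
    (r : ℂ) * (r + 1) * ∑ ν ∈ range (r + 1 + 1),
        ((Ring.choose ((((r + 1 : ℕ)) : ℝ) - α) ν *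
          Ring.choose ((((r + 1 : ℕ)) : ℝ) + α) (r + 1 - ν) : ℝ) : ℂ) * z ^ ν * u ^ (r + 1 - ν) =
      (r : ℂ) * (2 * r + 1) * (z + u) * ∑ ν ∈ range (r + 1),
        ((Ring.choose ((r : ℝ) - α) ν * Ring.choose ((r : ℝ) + α) (r - ν) : ℝ) : ℂ) *
          z ^ ν * u ^ (r - ν) -
      ((r : ℂ) ^ 2 - (α : ℂ) ^ 2) * (z - u) ^ 2 * ∑ ν ∈ range (r - 1 + 1),
        ((Ring.choose ((((r - 1 : ℕ)) : ℝ) - α) ν *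
          Ring.choose ((((r - 1 : ℕ)) : ℝ) + α) (r - 1 - ν) : ℝ) : ℂ) * z ^ ν * u ^ (r - 1 - ν) := by
  rw [homog_eq_pow_mul_sum _ z u hu, homog_eq_pow_mul_sum _ z u hu, homog_eq_pow_mul_sum _ z u hu,
    show z + u = (z / u + 1) * u by field_simp, show z - u = (z / u - 1) * u by field_simp]
  have h := binomialPadeQ_rec' α hr (z / u)
  obtain ⟨k, rfl⟩ : ∃ k, r = k + 1 := ⟨r - 1, by omega⟩
  simp only [Nat.add_sub_cancel] at h ⊢
  linear_combination u ^ (k + 1 + 1) * h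

/-- **Non-vanishing of the Casoratian of the homogenised Padé polynomials**
[cite: ChenVoutier1997, Lemma 7 applied with `a = d = 1`, `b = c = 0` as in the proof of
Theorem 5]: if `0 < |α| < 1`, `u ≠ 0` and `z ≠ u`, then `P_{r+1} Q_r ≠ P_r Q_{r+1}` for all `r`. -/
theorem homogPade_casoratian_ne_zero (α : ℝ) (hα0 : α ≠ 0) (hα1 : |α| < 1) (z u : ℂ)
    (hu : u ≠ 0) (hzu : z ≠ u) (r : ℕ) :
    (∑ ν ∈ range (r + 1 + 1), ((Ring.choose ((((r + 1 : ℕ)) : ℝ) - α) (r + 1 - ν) *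
        Ring.choose ((((r + 1 : ℕ)) : ℝ) + α) ν : ℝ) : ℂ) * z ^ ν * u ^ (r + 1 - ν)) *
      (∑ ν ∈ range (r + 1), ((Ring.choose ((r : ℝ) - α) ν *
        Ring.choose ((r : ℝ) + α) (r - ν) : ℝ) : ℂ) * z ^ ν * u ^ (r - ν)) ≠
    (∑ ν ∈ range (r + 1), ((Ring.choose ((r : ℝ) - α) (r - ν) *
        Ring.choose ((r : ℝ) + α) ν : ℝ) : ℂ) * z ^ ν * u ^ (r - ν)) *
      (∑ ν ∈ range (r + 1 + 1), ((Ring.choose ((((r + 1 : ℕ)) : ℝ) - α) ν *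
        Ring.choose ((((r + 1 : ℕ)) : ℝ) + α) (r + 1 - ν) : ℝ) : ℂ) * z ^ ν * u ^ (r + 1 - ν)) := by
  refine casoratian_ne_zero
    (K := fun R => ∑ ν ∈ range (R + 1), ((Ring.choose ((R : ℝ) - α) (R - ν) *
      Ring.choose ((R : ℝ) + α) ν : ℝ) : ℂ) * z ^ ν * u ^ (R - ν))
    (L := fun R => ∑ ν ∈ range (R + 1), ((Ring.choose ((R : ℝ) - α) ν *
      Ring.choose ((R : ℝ) + α) (R - ν) : ℝ) : ℂ) * z ^ ν * u ^ (R - ν))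
    (lam := fun R => (R : ℂ) * (R + 1)) (α := fun R => (R : ℂ) * (2 * R + 1) * (z + u))
    (β := fun R => ((R : ℂ) ^ 2 - (α : ℂ) ^ 2) * (z - u) ^ 2)
    (fun R hR => homogPadeP_rec α hR z u hu) (fun R hR => homogPadeQ_rec α hR z u hu)
    (fun R hR => ?_) ?_ r
  · -- `β_R ≠ 0`
    have h1 : ((R : ℂ) ^ 2 - (α : ℂ) ^ 2) ≠ 0 := by
      have hαsq : α ^ 2 < 1 := (sq_lt_one_iff_abs_lt_one α).mpr hα1
      have hR1 : (1 : ℝ) ≤ (R : ℝ) ^ 2 := by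
        have : (1 : ℝ) ≤ R := by exact_mod_cast hR
        nlinarith
      have : ((R : ℝ) ^ 2 - α ^ 2 : ℝ) ≠ 0 := by linarith
      have h' : ((R : ℂ) ^ 2 - (α : ℂ) ^ 2) = (((R : ℝ) ^ 2 - α ^ 2 : ℝ) : ℂ) := by push_cast; ring
      rw [h']
      exact_mod_cast this
    exact mul_ne_zero h1 (pow_ne_zero 2 (sub_ne_zero.mpr hzu))
  · -- the initial Casoratian `P_1 Q_0 - P_0 Q_1 = 2α(z-u) ≠ 0`
    simp only [sum_range_succ, sum_range_zero, zero_add, Nat.cast_zero, Nat.cast_one,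
      Ring.choose_zero_right, Nat.sub_zero, Nat.sub_self, pow_zero, pow_one, mul_one, one_mul]
    rw [Ring.choose_one_right, Ring.choose_one_right]
    intro h
    push_cast at h
    have h2 : (2 * (α : ℂ)) * (z - u) = 0 := by linear_combination h
    rcases mul_eq_zero.mp h2 with h3 | h3
    · exact hα0 (by exact_mod_cast (mul_eq_zero.mp h3).resolve_left two_ne_zero)
    · exact hzu (sub_eq_zero.mp h3)

end Literature.NumberTheory.DiophantineApproximation
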